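import Summits.CriticalPhenomena.CardyFormulaZ2.Theorems.CardyBondTriangularBondTriangularCardyEquicontinuityOfArms
import Summits.CriticalPhenomena.CardyFormulaZ2.Theorems.CardyBondTriangularBondTriangularCardyClSepYellowArms
import Summits.CriticalPhenomena.CardyFormulaZ2.Theorems.CardyBondTriangularBondTriangularCardyYellowSmall
import Summits.CriticalPhenomena.CardyFormulaZ2.Theorems.CardyBondTriangularBondTriangularCardyBlueOfYellow
import HarnessLib

/-!
# Route CardyBondTriangular · crux `BondTriangularCardy` · line `birth`: the p. 198 equicontinuity estimate for critical bond-`𝕋` from the blue arm of Claim 10 and RSW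

Helper of the stub `stub_equicontinuity`: the complete reduction of the registered signature
`Sig.stub_equicontinuity = BondTriangularBoxCrossing → Sig.equicontinuity` (Bollobás–Riordan,
*Percolation* (2006), Ch. 7, proof of Claim 22 p. 198, for the Chayes–Lei separating
probabilities `clSepProb` of critical bond percolation on `𝕋`) to ONE combinatorial statement,
the blue arm of Claim 10 (p. 177) for the Chayes–Lei separating events (registered stub
`clSepEvent_diff_subset_blueArm`): `equicontinuity_of_blueArm`. All other inputs are theorems:
the assembly `equicontinuity_of_arms_of_annulusBounds`, the yellow arms
`clSepEvent_diff_subset_yellowArms`, the yellow annulus bound from RSW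
`clYellowAnnulus_small_of_boxCrossing` (Grimmett–Manolescu strip argument,
`triIso_openArm_le_pow`), the blue annulus bound `clBlueAnnulus_small_of_yellow` (self-duality
of `triBondCritical`, Chayes–Lei 2006 Prop. 2.1).

## References

* B. Bollobás, O. Riordan, *Percolation*, CUP (2006), Ch. 7: Claim 22 p. 198, (35) p. 197,
  Claim 10 p. 177, Lemma 4 pp. 166–167.
* L. Chayes, H. K. Lei, J. Stat. Phys. 122 (2006) Prop. 2.1; Rev. Math. Phys. 19 (2007) §2.
* G. R. Grimmett, I. Manolescu, Ann. Probab. 41 (2013) §4.1; PTRF 159 (2014) Thm. 4 (b).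
-/

noncomputable section

namespace Summit.CriticalPhenomena.CardyFormulaZ2.Theorems

open Set Filter Topology Metric MeasureTheory
open Literature.Probability.Percolation Literature.Probability.RandomPlanarGeometry
open Literature.Probability.LatticeModels

/-- **The p. 198 equicontinuity estimate for critical bond-`𝕋` from the blue arm of Claim 10 and
RSW** (Bollobás–Riordan 2006, Ch. 7, proof of Claim 22 p. 198, for the Chayes–Lei separating
probabilities `clSepProb` of critical bond percolation on `𝕋`): the assembly
`equicontinuity_of_arms_of_annulusBounds` with its four hypotheses discharged but one — the
yellow arms by `clSepEvent_diff_subset_yellowArms`, the yellow annulus bound by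
`clYellowAnnulus_small_of_boxCrossing` (from the box-crossing property of critical bond-`𝕋`,
route item `BondTriangularBoxCrossing`), the blue annulus bound by `clBlueAnnulus_small_of_yellow`
(self-duality of `triBondCritical`) — leaving the BLUE ARM of Claim 10 for the Chayes–Lei
separating events (on `Eⁱ(z) ∖ Eⁱ(w)` a hexagon of `w` is blue-connected to `Aᵢ`) as the only
hypothesis besides RSW. -/
theorem equicontinuity_of_blueArm : (∀ (D : Literature.Probability.Percolation.TriMarkedDomain 3) (w : Literature.Probability.LatticeModels.HexVertex) (i j : Fin 3), Literature.Probability.LatticeModels.hexFaceVertices w ⊆ D.verts → D.clSepEvent i (Literature.Probability.Percolation.oppFace w j) \ D.clSepEvent i w ⊆ {σ | ∃ k : Fin 3, ∃ u ∈ D.arc i, (Literature.Probability.Percolation.clBlueGraph σ).Reachable (Literature.Probability.Percolation.faceVertex w k) u}) → Summit.CriticalPhenomena.CardyFormulaZ2.Theses.CardyBondTriangular.BondTriangularBoxCrossing → ∀ (R : Literature.Probability.RandomPlanarGeometry.ConformalRectangle) (G : ℝ → Literature.Probability.Percolation.TriMarkedDomain 4), Literature.Probability.Percolation.IsDiscreteApprox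 R G → ∀ β > (0 : ℝ), ∃ γ > (0 : ℝ), ∀ᶠ δ : ℝ in 𝓝[>] 0, ∀ (i : Fin 3) (w z : Literature.Probability.LatticeModels.HexVertex), w ∈ (G δ).faces → Relation.ReflTransGen (fun x y : Literature.Probability.LatticeModels.HexVertex => Literature.Probability.LatticeModels.hexGraph.Adj x y ∧ y ∈ (G δ).faces ∧ dist ((δ : ℂ) * Literature.Probability.LatticeModels.hexCenter w) ((δ : ℂ) * Literature.Probability.LatticeModels.hexCenter y) < 2 * γ) w z → (G δ).dropLast.clSepProb Literature.Probability.Percolation.ChayesLeiHexPercolation.triBondCritical i z - (G δ).dropLast.clSepProb Literature.Probability.Percolation.ChayesLeiHexPercolation.triBondCritical i w ≤ β :=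
  fun hB hRSW =>
    equicontinuity_of_arms_of_annulusBounds ChayesLeiHexPercolation.triBondCritical
      clSepEvent_diff_subset_yellowArms hB (clYellowAnnulus_small_of_boxCrossing hRSW)
      (clBlueAnnulus_small_of_yellow _ ChayesLeiHexPercolation.isSelfDual_triBondCritical
        (clYellowAnnulus_small_of_boxCrossing hRSW))

end Summit.CriticalPhenomena.CardyFormulaZ2.Theorems

end
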